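import Literature.NumberTheory.Rogawski1990.UnitOrbitalIntegralInertCountJPos
import Literature.NumberTheory.Rogawski1990.UnitOrbitalIntegralInertValuesTheta
import Literature.NumberTheory.Automorphic.UnitaryThreeBorelCosetCountJZeroNear
import Literature.NumberTheory.Automorphic.UnitaryThreeBorelConjugateCongruencesJZero
import Literature.NumberTheory.Automorphic.UnitaryThreePHTowerPackage
import HarnessLib

/-!
# Flicker's PROPOSITION 13 AS A COSET COUNT (regime `m ≤ N`): `#{y ∈ P_H ⧸ (P_H ∩ H^K_m) : y⁻¹ τ₀ y ∈ H^K_m} = iThirteen q N N₊ M m`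
(Flicker (1998), *Elementary proof of the fundamental lemma for a unitary group*, Prop. 13 pp. 91–93, cases (a)(b)(c); Prop. 8 p. 84)

Topic `NumberTheory/Rogawski1990` (road «D-N7-inert», MAP v3 (F8) PROP. 13 — the PACKAGING of LAYER B (13-i) CORE-0 (p04 (g12) ★ `UnitaryThreeBorelConjugateCongruencesJZero`)
with (13-ii) COUNT-0 (F0P3b-p01 (g6) ★ `UnitaryThreeBorelCosetCountJZero`∕`…Near`) against A-p03 (g24)'s ★ `iThirteen`); namespace `Literature.NumberTheory.Automorphic.UnitaryGroup`;
the `j = 0` twin of ★ A-p03 `natCard_cosets_eq_iTen` (same binder text).  THEOREMS ONLY: no definition, no named fact, no instance, no notation, no `sorry`; kernel lane.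
Pen F0P3b-p01 (g6) (A-p03 (g24) «=» 05:32:29Z; LEAD F0P3a-plan (g9) T8-70 (C)).  HONEST LABEL: HC_CM is proved only modulo the 2 remaining named inputs (hLiu418, h413)
until rung 0 closes; this file is a junction and proves no letter by itself.

THE STATEMENT.  `τ₀ = !![A,0,B; 0,b,0; B,0,A] ∈ U` commuting with `c = diag(1,−1,1)` (the `j = 0` member of Flicker's torus family), `|B| = |ϖ^N|`, `|A − b| = |ϖ^{N₊}|`,
`(A − b)∕B = f + g` with `σf = f`, `σg = −g`, `|f| ≤ 1` (p04's split of Flicker's `−x = d∕2`), and the REGIME DATUM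
`N₊ < N ∨ (N ≤ N₊ ∧ N ≤ M ∧ |f² − 1| = |ϖ^{M−N}| ∧ |g| = |ϖ^M|)` (Flicker's type (1): `{N₁, N₂} = {N, M}` when `N ≤ N₊`, `|f²−1| = |c₀| = |ϖ^{N₁+N₂−2N}|`, `|g| = |ϖ^{N₁+N₂−N}|`).
Then for `m ≤ N`: **`(#{good cosets} : ℚ) = iThirteen q N N₊ M m`** — `m = 0`: one coset; `2m ≤ min(N, N₊)`: all of `[P_H : P_H ∩ H^K_m] = (q²−1)q^{4m−2}` (CORE-0 (R-a)
`conditions_of_le_sq`); `N₊ < N`, `2m > N₊`: none ((R-kill) `not_condition_four_of_v_lt`); `N < 2m ≤ M`: case (b), (R-bd) `conditions_iff_v_le_of_bounded` + ★ J2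
`natCard_cosets_of_iff_small` = `(1+q⁻¹)q^{2m+2[N∕2]}`; `M < 2m`, `m ≤ N`, `M − N` even: case (c), (R-ce) `conditions_iff_norm_sub_le_of_near` + ★ J4 `natCard_cosets_of_iff_norm_sub_le`
= `(1+q⁻¹)²q^{2m+N}`; `M − N` odd there: none (parity, `even_of_norm_sub_le_of_near`).  Prop. 8's numbers (`[P_H : P_H ∩ H^K_m]`, `P_H ∩ H^K_m ≤ N₀`, finiteness, fibres `q^m`)
enter as the hypotheses `hidx0 hidx hSN hfib` exactly as in ★ `natCard_cosets_eq_iTen` (discharged by B-p04's ★ `UnitaryThreePHTowerPackage` in the sequel).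
NOT here: `m > N` (cases (d)(e) and the far∕kill zeros beyond `N`).

## References
* [Flicker1998UnitaryFL] Y. Z. Flicker, *Elementary proof of the fundamental lemma for a unitary group*, Canad. J. Math. 50 (1998), 74–98: Prop. 13 pp. 91–93, Prop. 8 p. 84.
* [Rogawski1990] J. D. Rogawski, *Automorphic Representations of Unitary Groups in Three Variables* (1990), §4.9 p. 55.
-/

set_option autoImplicit false

open scoped MatrixGroups WithZero Valued
open Matrix

namespace Literature.NumberTheory.Automorphic

namespace UnitaryGroup

open Literature.NumberTheory.Automorphic.HermitianLattice (unitaryInt mem_unitaryInt_iff LocalConjDatum)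
open Literature.NumberTheory.Rogawski1990.Flicker1998 (iThirteen natCast_count_b_eq natCast_count_c_eq)
open IsLocalRing

variable {K : Type*} [Field K] [Valued K ℤᵐ⁰] {ϖ : K} (σ : K →+* K) {J : Matrix (Fin 3) (Fin 3) K}

/-! ## §0 Arithmetic of the values -/

/-- `q^{m′+1}·(q^h·q^{m′}(q+1)·q^h) = (1 + q⁻¹)·q^{2(m′+1)+2h}` in `ℚ` (case (b): `m = m′+1`, `h = [N∕2] = m − k`). [cite: Flicker1998UnitaryFL, Prop. 13 p. 93] -/
theorem cast_count_b_pack {q : ℕ} (hq : q ≠ 0) (m' h : ℕ) :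
    ((q ^ (m' + 1) * (q ^ h * (q ^ m' * (q + 1)) * q ^ h) : ℕ) : ℚ) = (1 + ((q : ℚ))⁻¹) * (q : ℚ) ^ (2 * (m' + 1) + 2 * h) := by
  have hq' : (q : ℚ) ≠ 0 := by exact_mod_cast hq
  push_cast
  field_simp
  ring

/-- `q^m·(q^{m−1}(q+1)·(q^{s+ℓ}·q^{r}(q+1))) = (1 + q⁻¹)²·q^{2m+N}` in `ℚ` for `m = ℓ+1+r`, `N = m+s` (case (c)). [cite: Flicker1998UnitaryFL, Prop. 13 p. 93] -/
theorem cast_count_c_pack {q : ℕ} (hq : q ≠ 0) (ℓ r s : ℕ) :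
    ((q ^ (ℓ + 1 + r) * ((q ^ (ℓ + r) * (q + 1)) * (q ^ (s + ℓ) * (q ^ r * (q + 1)))) : ℕ) : ℚ) =
      (1 + ((q : ℚ))⁻¹) ^ 2 * (q : ℚ) ^ (2 * (ℓ + 1 + r) + (ℓ + 1 + r + s)) := by
  have hq' : (q : ℚ) ≠ 0 := by exact_mod_cast hq
  push_cast
  field_simp
  ring

omit [Valued K ℤᵐ⁰] in
/-- `m ≤ a ∕ 2 ↔ 2m ≤ a` in `ℕ`. [cite: Flicker1998UnitaryFL, Prop. 13 p. 91] -/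
theorem le_div_two_iff {m a : ℕ} : m ≤ a / 2 ↔ 2 * m ≤ a := by
  rw [Nat.le_div_iff_mul_le (by norm_num)]; omega

/-- `|f| ≤ 1` and `|f² − 1| < 1` force `|f| = 1`. [cite: Flicker1998UnitaryFL, Prop. 13 p. 92] -/
theorem v_eq_one_of_v_sq_sub_one_lt {f : K} (hf1 : Valued.v f ≤ 1) (h : Valued.v (f ^ 2 - 1) < 1) : Valued.v f = 1 := by
  by_contra hne
  have hlt : Valued.v f < 1 := lt_of_le_of_ne hf1 hne
  have hf2 : Valued.v (f ^ 2) < Valued.v (-1 : K) := by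
    rw [map_pow, Valuation.map_neg, map_one]; exact pow_lt_one₀ zero_le hlt two_ne_zero
  have : Valued.v (f ^ 2 - 1) = 1 := by
    rw [show f ^ 2 - 1 = f ^ 2 + (-1) by ring, Valuation.map_add_eq_of_lt_right _ hf2, Valuation.map_neg, map_one]
  exact (lt_irrefl _) (this ▸ h)

/-! ## §1 Proposition 13 as a coset count, `m ≤ N` -/

section PropThirteen

variable [IsDiscreteValuationRing 𝒪[K]] [Finite (ResidueField 𝒪[K])] [IsAdicComplete (maximalIdeal 𝒪[K]) 𝒪[K]]

/-- **FLICKER'S PROPOSITION 13 (cases (a)(b)(c): `m ≤ N`) AS A COSET COUNT.**  For `τ₀ = !![A,0,B; 0,b,0; B,0,A] ∈ U^H` with `|B| = |ϖ^N|`, `|A − b| = |ϖ^{N₊}|`,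
`(A−b)∕B = f + g` (`σf = f`, `|f| ≤ 1`; `g` is the anti-fixed part, only its size enters) and the regime datum `N₊ < N ∨ (N ≤ N₊ ∧ N ≤ M ∧ |f²−1| = |ϖ^{M−N}| ∧ |g| = |ϖ^M|)`, and every `m ≤ N`:
`(#{y ∈ P_H ⧸ (P_H ∩ H^K_m) : y⁻¹ τ₀ y ∈ H^K_m} : ℚ) = iThirteen q N N₊ M m` — Prop. 8's numbers entering as `hidx0 hidx hSN hfib` (★ `natCard_cosets_eq_iTen`'s binder text).
Assembly: CORE-0's criteria (R-a)∕(R-kill)∕(R-bd)∕(R-ce)∕parity (p04 (g12)) read through ★ `borel_conj_mem_flickerHK_iff` at `B₁ = B₂ = B`, counted by ★ `natCard_cosets_eq_index_of_forall`,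
★ `natCard_cosets_eq_zero_of_forall_not`, ★ J2 `natCard_cosets_of_iff_small`, ★ J4 `natCard_cosets_of_iff_norm_sub_le`. [cite: Flicker1998UnitaryFL, Prop. 13 pp. 91–93; Prop. 8 p. 84] -/
theorem natCard_cosets_eq_iThirteen (hJ : J = (StdForm.antidiagonal 3).over K) (hd : LocalConjDatum σ ϖ)
    (hσO : ∀ y : 𝒪[K], (σ.comp 𝒪[K].subtype) y ∈ 𝒪[K]) {y : K} (hy : y * σ y = -2)
    {m N Np M : ℕ} (hmN : m ≤ N)
    {c um τ : ↥(unitaryGroupOfForm σ J)} (hc : ((c : GL (Fin 3) K) : Matrix (Fin 3) (Fin 3) K) = !![1, 0, 0; 0, -1, 0; 0, 0, 1])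
    (hum : ((um : GL (Fin 3) K) : Matrix (Fin 3) (Fin 3) K) = !![ϖ ^ m, y, (ϖ ^ m)⁻¹; 0, 1, -σ y * (ϖ ^ m)⁻¹; 0, 0, (ϖ ^ m)⁻¹])
    {A B b f g : K} (hτ : ((τ : GL (Fin 3) K) : Matrix (Fin 3) (Fin 3) K) = !![A, 0, B; 0, b, 0; B, 0, A])
    (hτH : τ ∈ Subgroup.centralizer ({c} : Set ↥(unitaryGroupOfForm σ J)))
    (hB : Valued.v B = Valued.v (ϖ ^ N)) (hs : Valued.v (A - b) = Valued.v (ϖ ^ Np))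
    (hfg : (A - b) / B = f + g) (hσf : σ f = f) (hf1 : Valued.v f ≤ 1)
    (hreg : Np < N ∨ (N ≤ Np ∧ N ≤ M ∧ Valued.v (f ^ 2 - 1) = Valued.v (ϖ ^ (M - N)) ∧ Valued.v g = Valued.v (ϖ ^ M)))
    {q : ℕ} (hq : Nat.card (ResidueField 𝒪[K]) = q ^ 2)
    {a₀ : 𝒪[K]} (ha₀ : IsUnit (((σ.comp 𝒪[K].subtype).codRestrict 𝒪[K] hσO) a₀ - a₀))
    (hidx0 : m = 0 → ((flickerHK σ J c um).subgroupOf (flickerPH σ J c)).index = 1)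
    (hidx : 1 ≤ m → ((flickerHK σ J c um).subgroupOf (flickerPH σ J c)).index = (q ^ 2 - 1) * q ^ (4 * m - 2))
    (hSN : flickerPH σ J c ⊓ flickerHK σ J c um ≤ flickerPH0 σ J c (ϖ ^ m))
    [Finite (↥(flickerPH σ J c) ⧸ (flickerHK σ J c um).subgroupOf (flickerPH σ J c))]
    (hfib : ∀ z ∈ Set.range (fun w : ↥(flickerPH σ J c) ⧸ (flickerHK σ J c um).subgroupOf (flickerPH σ J c) =>
        flickerPHRho σ m ((Quotient.out w : ↥(flickerPH σ J c)) : ↥(unitaryGroupOfForm σ J))),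
      Nat.card {w : ↥(flickerPH σ J c) ⧸ (flickerHK σ J c um).subgroupOf (flickerPH σ J c) //
        flickerPHRho σ m ((Quotient.out w : ↥(flickerPH σ J c)) : ↥(unitaryGroupOfForm σ J)) = z} = q ^ m) :
    (Nat.card {w : ↥(flickerPH σ J c) ⧸ (flickerHK σ J c um).subgroupOf (flickerPH σ J c) //
      ((Quotient.out w : ↥(flickerPH σ J c)) : ↥(unitaryGroupOfForm σ J))⁻¹ * τ * (Quotient.out w : ↥(flickerPH σ J c)) ∈ flickerHK σ J c um} : ℚ) =
      iThirteen q N Np M m := by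
  have hq0 : q ≠ 0 := by
    rintro rfl
    have h1 : 0 < Nat.card (ResidueField 𝒪[K]) := Nat.card_pos
    rw [hq] at h1; simp at h1
  have hq1 : 1 ≤ q := Nat.one_le_iff_ne_zero.2 hq0
  have hϖ0 : ϖ ≠ 0 := hd.ϖ_ne_zero
  have hB0 : B ≠ 0 := fun h => by
    rw [h, map_zero] at hB; exact (pow_ne_zero _ hϖ0) ((map_eq_zero _).1 hB.symm)
  have hvmm : Valued.v (ϖ ^ m) * Valued.v (ϖ ^ m) = Valued.v (ϖ ^ (2 * m)) := by rw [← map_mul, ← pow_add, two_mul]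
  have hB1 : Valued.v B ≤ 1 := by rw [hB]; exact hd.v_pow_le_one N
  have h2 : (2 : K) ≠ 0 := fun h => by have := hd.v2; rw [h, map_zero] at this; exact zero_ne_one this
  have hτ0 : ((τ : GL (Fin 3) K) : Matrix (Fin 3) (Fin 3) K) = !![A, 0, B * ϖ ^ (2 * 0); 0, b, 0; B, 0, A] := by
    rw [hτ, mul_zero, pow_zero, mul_one]
  -- the conjugation condition for `p = p(u,x,w) ∈ P_H` is (2)∧(3)∧(4) at `n = uσu` (condition (1) `|nB| ≤ 1` is free)
  have hiff : ∀ p ∈ flickerPH σ J c, ∀ u x w : K,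
      ((p : GL (Fin 3) K) : Matrix (Fin 3) (Fin 3) K) = !![u, 0, u * x; 0, w, 0; 0, 0, (σ u)⁻¹] → Valued.v u = 1 → Valued.v w = 1 →
        (p⁻¹ * τ * p ∈ flickerHK σ J c um ↔
          Valued.v (A - b + (u * σ u) * B * (1 - x)) ≤ Valued.v (ϖ ^ m) ∧
          Valued.v (A - b + (u * σ u) * B * (1 + x)) ≤ Valued.v (ϖ ^ m) ∧
          Valued.v (2 * (A - b) + B * (u * σ u)⁻¹ + (u * σ u) * B * (1 - x ^ 2)) ≤ Valued.v (ϖ ^ m) * Valued.v (ϖ ^ m)) := by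
    intro p hp u x w hpm hvu hvw
    have hu0 : u ≠ 0 := fun h => by rw [h, map_zero] at hvu; exact zero_ne_one hvu
    have hσu0 : σ u ≠ 0 := fun h => hu0 (by rw [← hd.σσ u, h, map_zero])
    have hw0 : w ≠ 0 := fun h => by rw [h, map_zero] at hvw; exact zero_ne_one hvw
    have hn : Valued.v (u * σ u) = 1 := by rw [map_mul, hd.vσ, hvu, mul_one]
    have hpH : p ∈ Subgroup.centralizer ({c} : Set ↥(unitaryGroupOfForm σ J)) := ((mem_flickerPH_iff h2 hc).1 hp).1.1
    rw [borel_conj_mem_flickerHK_iff σ hJ hd hy m hu0 hσu0 hw0 hum hpm hτ0 hpH hτH,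
      show B * ϖ ^ (2 * 0) = B by rw [mul_zero, pow_zero, mul_one]]
    have h1 : Valued.v ((u * σ u) * B) ≤ 1 := by rw [map_mul, hn, one_mul]; exact hB1
    exact and_iff_right h1
  -- coordinates of a `P_H` element
  have hcoord : ∀ p ∈ flickerPH σ J c, ∃ u x w : K,
      ((p : GL (Fin 3) K) : Matrix (Fin 3) (Fin 3) K) = !![u, 0, u * x; 0, w, 0; 0, 0, (σ u)⁻¹] ∧ Valued.v u = 1 ∧ Valued.v x ≤ 1 ∧
        σ x = -x ∧ Valued.v w = 1 := by
    intro p hp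
    obtain ⟨u, x, w, hpm, hvu, hvx, hσx, hvw, -⟩ := exists_coe_eq_borel_of_mem_flickerPH σ hJ hd hc hp
    exact ⟨u, x, w, hpm, hvu, hvx, hσx, hvw⟩
  -- regime «all»: the full index
  have hall : Valued.v (A - b) ≤ Valued.v (ϖ ^ m) * Valued.v (ϖ ^ m) → Valued.v B ≤ Valued.v (ϖ ^ m) * Valued.v (ϖ ^ m) →
      Nat.card {w : ↥(flickerPH σ J c) ⧸ (flickerHK σ J c um).subgroupOf (flickerPH σ J c) //
        ((Quotient.out w : ↥(flickerPH σ J c)) : ↥(unitaryGroupOfForm σ J))⁻¹ * τ * (Quotient.out w : ↥(flickerPH σ J c)) ∈ flickerHK σ J c um} =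
      ((flickerHK σ J c um).subgroupOf (flickerPH σ J c)).index := by
    intro hs2 hB2
    refine natCard_cosets_eq_index_of_forall σ fun p hp => ?_
    obtain ⟨u, x, w, hpm, hvu, hvx, -, hvw⟩ := hcoord p hp
    have hn : Valued.v (u * σ u) = 1 := by rw [map_mul, hd.vσ, hvu, mul_one]
    exact (hiff p hp u x w hpm hvu hvw).2 (conditions_of_le_sq σ hd hn hvx hs2 hB2)
  rcases Nat.eq_zero_or_pos m with hm0 | hm
  · -- m = 0 : everything solves, one coset
    subst hm0
    rw [hall (by rw [hs, hvmm, v_pow_le_v_pow_iff σ hd]; omega) (by rw [hB, hvmm, v_pow_le_v_pow_iff σ hd]; omega),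
      hidx0 rfl, iThirteen, if_pos rfl, Nat.cast_one]
  have hm0 : m ≠ 0 := by omega
  by_cases ha2 : 2 * m ≤ N ∧ 2 * m ≤ Np
  · -- case (a): `m ≤ min([N∕2],[N₊∕2])`
    rw [hall (by rw [hs, hvmm, v_pow_le_v_pow_iff σ hd]; exact ha2.2) (by rw [hB, hvmm, v_pow_le_v_pow_iff σ hd]; exact ha2.1),
      hidx hm, cast_index_eq hq0 hm, iThirteen, if_neg hm0, if_pos (le_min (le_div_two_iff.2 ha2.1) (le_div_two_iff.2 ha2.2))]
  have hnotA : ¬ m ≤ min (N / 2) (Np / 2) := fun h => ha2 ⟨le_div_two_iff.1 (le_min_iff.1 h).1, le_div_two_iff.1 (le_min_iff.1 h).2⟩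
  rcases hreg with hA | ⟨hNNp, hNM, hc₁, hgM⟩
  · -- `N₊ < N` and `2m > N₊` : no solution (R-kill)
    have h2m : Np < 2 * m := by omega
    have hzero : Nat.card {w : ↥(flickerPH σ J c) ⧸ (flickerHK σ J c um).subgroupOf (flickerPH σ J c) //
        ((Quotient.out w : ↥(flickerPH σ J c)) : ↥(unitaryGroupOfForm σ J))⁻¹ * τ * (Quotient.out w : ↥(flickerPH σ J c)) ∈ flickerHK σ J c um} = 0 := by
      refine natCard_cosets_eq_zero_of_forall_not σ fun p hp hmem => ?_
      obtain ⟨u, x, w, hpm, hvu, hvx, -, hvw⟩ := hcoord p hp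
      have hn : Valued.v (u * σ u) = 1 := by rw [map_mul, hd.vσ, hvu, mul_one]
      exact not_condition_four_of_v_lt σ hd hn hvx (by rw [hB, hs, v_pow_lt_v_pow_iff σ hd]; exact hA)
        (by rw [hs, hvmm, v_pow_lt_v_pow_iff σ hd]; exact h2m) ((hiff p hp u x w hpm hvu hvw).1 hmem).2.2
    rw [hzero, Nat.cast_zero, iThirteen, if_neg hm0, if_neg hnotA, if_neg (fun h => by omega), if_neg (fun h => by omega),
      if_neg (fun h => by omega), if_neg (fun h => by omega)]
  -- `N ≤ N₊`: cases (b), (c) and the parity zero (m ≤ N throughout)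
  have hN2 : N < 2 * m := by
    by_contra h; exact ha2 ⟨by omega, by omega⟩
  have hN2' : N ≤ 2 * m := hN2.le
  by_cases hbM : 2 * m ≤ M
  · -- case (b): `N < 2m ≤ M`
    have hMN : N < M := by omega
    have hc₁' : Valued.v (f ^ 2 - 1) ≤ Valued.v (ϖ ^ (2 * m - N)) := by rw [hc₁, v_pow_le_v_pow_iff σ hd]; omega
    have hg' : Valued.v g ≤ Valued.v (ϖ ^ (2 * m - N)) := by rw [hgM, v_pow_le_v_pow_iff σ hd]; omega
    have hfv : Valued.v f = 1 := v_eq_one_of_v_sq_sub_one_lt hf1 (by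
      rw [hc₁, hd.v_pow, ← WithZero.exp_zero, WithZero.exp_lt_exp]; have : 0 < M - N := by omega
      omega)
    have hk1 : 1 ≤ m - N / 2 := by omega
    have hkm : m - N / 2 ≤ m := Nat.sub_le _ _
    have hcount := natCard_cosets_of_iff_small σ hJ hd hσO hm hk1 hkm hc hfv hσf
      (fun p hp u x w hpm => by
        obtain ⟨u', x', w', hpm', hvu, hvx, hσx, hvw⟩ := hcoord p hp
        -- the coordinates are determined by the matrix
        have hu' : u' = u := by have := congrFun (congrFun (hpm'.symm.trans hpm) 0) 0; simpa using this
        have hw' : w' = w := by have := congrFun (congrFun (hpm'.symm.trans hpm) 1) 1; simpa using this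
        subst hu' hw'
        have hu0 : u' ≠ 0 := fun h => by rw [h, map_zero] at hvu; exact zero_ne_one hvu
        have hx' : x' = x := by
          have := congrFun (congrFun (hpm'.symm.trans hpm) 0) 2
          simpa [hu0] using this
        subst hx'
        have hn : Valued.v (u' * σ u') = 1 := by rw [map_mul, hd.vσ, hvu, mul_one]
        have hσn : σ (u' * σ u') = u' * σ u' := by rw [map_mul, hd.σσ, mul_comm]
        rw [hiff p hp u' x' w' hpm hvu hvw]
        exact conditions_iff_v_le_of_bounded σ hd hB hN2' hn hσn hσx hfg hσf hf1 hc₁' hg')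
      hq ha₀ hSN hfib
    rw [hcount, iThirteen, if_neg hm0, if_neg hnotA, if_pos ⟨hNNp, by omega, le_min hmN (le_div_two_iff.2 hbM)⟩]
    obtain ⟨m', rfl⟩ : ∃ m', m = m' + 1 := ⟨m - 1, by omega⟩
    rw [show m' + 1 - (m' + 1 - N / 2) = N / 2 by omega, show m' + 1 - 1 = m' by omega, cast_count_b_pack hq0 m' (N / 2)]
  · -- `M < 2m`, `m ≤ N`
    have hMm : M < 2 * m := by omega
    have hnear : Valued.v (ϖ ^ (2 * m - N)) < Valued.v (f ^ 2 - 1) := by rw [hc₁, v_pow_lt_v_pow_iff σ hd]; omega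
    have hfar : Valued.v (f ^ 2 - 1) ≤ Valued.v (ϖ ^ (2 * (m - N))) := by
      rw [hc₁, show 2 * (m - N) = 0 by omega, v_pow_le_v_pow_iff σ hd]; exact Nat.zero_le _
    have hg' : Valued.v g ≤ Valued.v (ϖ ^ (2 * m - N)) := by rw [hgM, v_pow_le_v_pow_iff σ hd]; omega
    -- the criterion (R-ce) for every `p`
    have hce : ∀ p ∈ flickerPH σ J c, ∀ u x w : K,
        ((p : GL (Fin 3) K) : Matrix (Fin 3) (Fin 3) K) = !![u, 0, u * x; 0, w, 0; 0, 0, (σ u)⁻¹] →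
          (p⁻¹ * τ * p ∈ flickerHK σ J c um ↔
            Valued.v (((u * σ u)⁻¹ + f + x) * σ ((u * σ u)⁻¹ + f + x) - (f ^ 2 - 1)) ≤ Valued.v (ϖ ^ (2 * m - N))) := by
      intro p hp u x w hpm
      obtain ⟨u', x', w', hpm', hvu, hvx, hσx, hvw⟩ := hcoord p hp
      have hu' : u' = u := by have := congrFun (congrFun (hpm'.symm.trans hpm) 0) 0; simpa using this
      have hw' : w' = w := by have := congrFun (congrFun (hpm'.symm.trans hpm) 1) 1; simpa using this
      subst hu' hw'
      have hu0 : u' ≠ 0 := fun h => by rw [h, map_zero] at hvu; exact zero_ne_one hvu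
      have hx' : x' = x := by
        have := congrFun (congrFun (hpm'.symm.trans hpm) 0) 2
        simpa [hu0] using this
      subst hx'
      have hn : Valued.v (u' * σ u') = 1 := by rw [map_mul, hd.vσ, hvu, mul_one]
      have hσn : σ (u' * σ u') = u' * σ u' := by rw [map_mul, hd.σσ, mul_comm]
      rw [hiff p hp u' x' w' hpm hvu hvw]
      exact conditions_iff_norm_sub_le_of_near σ hd hB hN2' hn hσn hσx hfg hσf hf1 hg' hnear hfar
    by_cases hpar : (M - N) % 2 = 0
    · -- case (c): `M − N = 2ℓ`
      obtain ⟨ℓ, hℓ⟩ : ∃ ℓ, M - N = 2 * ℓ := ⟨(M - N) / 2, by omega⟩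
      have hj : 2 * ℓ < 2 * m - N := by omega
      have hjm : 2 * m - N ≤ m := by omega
      -- `f² − 1 = ϖ^{2ℓ}·γ` with `γ` a `σ`-fixed unit
      obtain ⟨γ, hγdef⟩ : ∃ γ : K, γ = (f ^ 2 - 1) / ϖ ^ (2 * ℓ) := ⟨_, rfl⟩
      have hγ : Valued.v γ = 1 := by
        rw [hγdef, map_div₀, hc₁, hℓ, div_self (Valuation.ne_zero_iff _ |>.2 (pow_ne_zero _ hϖ0))]
      have hσγ : σ γ = γ := by rw [hγdef, map_div₀, map_sub, map_pow, map_pow, hσf, hd.σϖ, map_one]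
      have hec : f ^ 2 - 1 = ϖ ^ (2 * ℓ) * γ := by rw [hγdef, ← mul_div_assoc, mul_div_cancel_left₀ _ (pow_ne_zero _ hϖ0)]
      have hcount := natCard_cosets_of_iff_norm_sub_le σ hJ hd hσO hm hj hjm hc hf1 hσf hγ hσγ hec hce hq ha₀ hSN hfib
      rw [hcount, iThirteen, if_neg hm0, if_neg hnotA,
        if_neg (fun h => by have := (le_min_iff.1 h.2.2).2; rw [le_div_two_iff] at this; omega),
        if_pos ⟨hNNp, by rw [Nat.add_one_le_iff, Nat.div_lt_iff_lt_mul (by norm_num)]; omega, hmN, hpar⟩]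
      obtain ⟨r, hr⟩ : ∃ r, m = ℓ + 1 + r := ⟨m - ℓ - 1, by omega⟩
      obtain ⟨s', hs'⟩ : ∃ s', N = m + s' := ⟨N - m, by omega⟩
      rw [show m - ℓ - (2 * m - N - 2 * ℓ) = s' + ℓ by omega, show m - ℓ - 1 = r by omega, show m - 1 = ℓ + r by omega]
      subst hs'
      subst hr
      exact cast_count_c_pack hq0 ℓ r s'
    · -- `M − N` odd : no solution (parity)
      have hzero : Nat.card {w : ↥(flickerPH σ J c) ⧸ (flickerHK σ J c um).subgroupOf (flickerPH σ J c) //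
          ((Quotient.out w : ↥(flickerPH σ J c)) : ↥(unitaryGroupOfForm σ J))⁻¹ * τ * (Quotient.out w : ↥(flickerPH σ J c)) ∈ flickerHK σ J c um} = 0 := by
        refine natCard_cosets_eq_zero_of_forall_not σ fun p hp hmem => ?_
        obtain ⟨u, x, w, hpm, hvu, hvx, -, hvw⟩ := hcoord p hp
        have h := (hce p hp u x w hpm).1 hmem
        obtain ⟨e, he⟩ := even_of_norm_sub_le_of_near σ hd hnear h
        rw [hc₁, hd.v_pow, WithZero.exp_inj] at he
        omega
      rw [hzero, Nat.cast_zero, iThirteen, if_neg hm0, if_neg hnotA, if_neg (fun h => by have := (le_min_iff.1 h.2.2).2; rw [le_div_two_iff] at this; omega),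
        if_neg (fun h => hpar h.2.2.2), if_neg (fun h => by omega), if_neg (fun h => hpar h.2.2.2)]

/-- **PROPOSITION 13 (`m ≤ N`), closed form**: the same with Prop. 8's numbers DISCHARGED by B-p04's ★ `UnitaryThreePHTowerPackage` (`finite_quotient_flickerHK`,
`index_flickerHK_subgroupOf_flickerPH_eq_one`∕`_eq`, `inf_flickerHK_le_flickerPH0`, `natCard_fibre_flickerPHRho_eq`) — the `j = 0` twin of ★ `natCard_cosets_eq_iTen_of_package`.
[cite: Flicker1998UnitaryFL, Prop. 13 pp. 91–93; Prop. 8 p. 84] -/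
theorem natCard_cosets_eq_iThirteen_of_package (hJ : J = (StdForm.antidiagonal 3).over K) (hd : LocalConjDatum σ ϖ)
    (hσO : ∀ y : 𝒪[K], (σ.comp 𝒪[K].subtype) y ∈ 𝒪[K]) {y : K} (hy : y * σ y = -2)
    {m N Np M : ℕ} (hmN : m ≤ N)
    {c um τ : ↥(unitaryGroupOfForm σ J)} (hc : ((c : GL (Fin 3) K) : Matrix (Fin 3) (Fin 3) K) = !![1, 0, 0; 0, -1, 0; 0, 0, 1])
    (hum : ((um : GL (Fin 3) K) : Matrix (Fin 3) (Fin 3) K) = !![ϖ ^ m, y, (ϖ ^ m)⁻¹; 0, 1, -σ y * (ϖ ^ m)⁻¹; 0, 0, (ϖ ^ m)⁻¹])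
    {A B b f g : K} (hτ : ((τ : GL (Fin 3) K) : Matrix (Fin 3) (Fin 3) K) = !![A, 0, B; 0, b, 0; B, 0, A])
    (hτH : τ ∈ Subgroup.centralizer ({c} : Set ↥(unitaryGroupOfForm σ J)))
    (hB : Valued.v B = Valued.v (ϖ ^ N)) (hs : Valued.v (A - b) = Valued.v (ϖ ^ Np))
    (hfg : (A - b) / B = f + g) (hσf : σ f = f) (hf1 : Valued.v f ≤ 1)
    (hreg : Np < N ∨ (N ≤ Np ∧ N ≤ M ∧ Valued.v (f ^ 2 - 1) = Valued.v (ϖ ^ (M - N)) ∧ Valued.v g = Valued.v (ϖ ^ M)))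
    {q : ℕ} (hq : Nat.card (ResidueField 𝒪[K]) = q ^ 2)
    {a₀ : 𝒪[K]} (ha₀ : IsUnit (((σ.comp 𝒪[K].subtype).codRestrict 𝒪[K] hσO) a₀ - a₀)) :
    (Nat.card {w : ↥(flickerPH σ J c) ⧸ (flickerHK σ J c um).subgroupOf (flickerPH σ J c) //
      ((Quotient.out w : ↥(flickerPH σ J c)) : ↥(unitaryGroupOfForm σ J))⁻¹ * τ * (Quotient.out w : ↥(flickerPH σ J c)) ∈ flickerHK σ J c um} : ℚ) =
      iThirteen q N Np M m := by
  haveI := finite_quotient_flickerHK σ hJ hd hy hσO m hum hc hq ha₀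
  refine natCard_cosets_eq_iThirteen σ hJ hd hσO hy hmN hc hum hτ hτH hB hs hfg hσf hf1 hreg hq ha₀ ?_ ?_
    (inf_flickerHK_le_flickerPH0 σ hJ hd hy m hum hc) (natCard_fibre_flickerPHRho_eq σ hJ hd hy hσO m hum hc hq ha₀)
  · rintro rfl
    exact index_flickerHK_subgroupOf_flickerPH_eq_one σ hJ hd hy hσO hum hc hq ha₀
  · intro hm
    exact index_flickerHK_subgroupOf_flickerPH_eq σ hJ hd hy hσO hm hum hc hq ha₀

end PropThirteen

end UnitaryGroup

end Literature.NumberTheory.Automorphic
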